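import Mathlib
import Literature.AlgebraicGeometry.Resolution.CobordantGame
import Literature.AlgebraicGeometry.Resolution.CobordantChartCoefficients
import Literature.AlgebraicGeometry.Resolution.CobordantChartPlaneSlice
import Literature.AlgebraicGeometry.Resolution.CobordantTupleGame
import Literature.AlgebraicGeometry.Resolution.FormalCoordinateChange
import Summits.ResolutionOfSingularities.ResolutionOfSingularities.Theorems.WeightedInvariantLocalWeightedDropTerminalDoublePointsDim
import Summits.ResolutionOfSingularities.ResolutionOfSingularities.Theorems.WeightedInvariantLocalWeightedDropSepTerminalDoublePointsDimAux

/-!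
# `WeightedInvariant.LocalWeightedDrop`: the SEPARABLE terminal double points in EVERY dimension — the line step, and two smooth sheets

Crux item stmt-ResolutionOfSingularities-8899 `LocalWeightedDrop` (route `ResolutionOfSingularities/WeightedInvariant`), skeleton v30,
residual stubs W4|₄ `stub_wildWideApexFourStartsWon` / W4|₅₊ `stub_wildWideApexFiveUpStartsWon` (`d = 2` slice).  [OURS · L1 W4.3, chain w43,
stub worker 4 (gen 4); NOT a statement of any manuscript.]

`won_dp1_of_lineStep` (every characteristic): the end-game move of the separable monomial case `y² + x^μ B · y + x^μ · U` (all `μ_l ≤ 1`,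
`U(0) ≠ 0`, at least three slots `a, b, e` with `μ = 1`): blow up the LINE `V(x_a, x_b, y)` (brick `won_monic_of_linearBlowup` with
`w = 𝟙_{a,b}`; the third slot makes both coefficients permissible, `B_0(0) = B_1(0) = 0`).  At a singular exceptional point the live
slot `i₀` is `a` or `b`; the slice is `y² + x^{μ'} B' y + x^{μ'} U'` with `U'(0) ≠ 0`, `μ' ≤ 1`, `μ'_{π e} = 1`, `Σ μ' < Σ μ`
(`π = Fin.cycleRange i₀`; the `y`-coefficient keeps an extra factor `s = x_{π i₀}`, absorbed in `B'`) — handed to an induction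
hypothesis on `Σ μ` stated in the class form `A₁ = x^{⌈μ'/2⌉} · B'` (`⌈μ'/2⌉ = μ'` since `μ' ≤ 1`).  The twin of
`TerminalDoublePointDim.won_dp_of_lineStep` (the case `B = 0`).

Also here: (M2) TWO SMOOTH SHEETS `sepSheetsDoublePointWon` (characteristic `2`, every field, every dimension): `y² + x^ν V · y + x^{2ν} · W`,
`V(0) ≠ 0`, is won — curve steps `V(x_i, y)` while `ν ≠ e_i` (`Σ ν` drops), bottom `ν = e_a` = `won_dp1_X_sq_mul`, `ν = 0` = the
`y`-linear term `V(0)`; and the exponent bookkeeping `prod_X_pow_ceil_eq_X_mul`, `prod_X_pow_two_mul_eq_X_sq_mul`.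
-/

set_option linter.dupNamespace false -- mandated namespace of this single-conjunct summit

namespace Summit.ResolutionOfSingularities.ResolutionOfSingularities.Theorems

open Literature.AlgebraicGeometry.Resolution
open Literature.AlgebraicGeometry.Resolution.CobordantGame

namespace SepTerminalDoublePointDim

open MvPowerSeries TerminalDoublePointDim

variable {k : Type} [Field k] {m : ℕ}

/-- For exponents `≤ 1` the ceiling `⌈μ/2⌉ = (μ + 1) / 2` is `μ` itself. -/
theorem prod_X_pow_ceil_eq_of_le_one (μ : Fin (m + 1) → ℕ) (hμ : ∀ l, μ l ≤ 1) :
    (∏ l, (X l : MvPowerSeries (Fin (m + 1)) k) ^ ((μ l + 1) / 2)) = ∏ l, (X l : MvPowerSeries (Fin (m + 1)) k) ^ μ l :=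
  Finset.prod_congr rfl fun l _ => by
    have h := hμ l
    congr 1
    omega

/-- THE LINE STEP AT THREE ODD SLOTS for `y² + x^μ B · y + x^μ · U` (all `μ_l ≤ 1`; see the module docstring). -/
theorem won_dp1_of_lineStep (p : ℕ) (hp : p.Prime) (k : Type) [Field k] [CharP k p] {m : ℕ} (μ : Fin (m + 1) → ℕ)
    (hμ : ∀ l, μ l ≤ 1) (a b e : Fin (m + 1)) (hab : a ≠ b) (hea : e ≠ a) (heb : e ≠ b)
    (ha : μ a = 1) (hb : μ b = 1) (he : μ e = 1) (U : MvPowerSeries (Fin (m + 1)) k) (hU : constantCoeff U ≠ 0)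
    (Bc : MvPowerSeries (Fin (m + 1)) k)
    (IH : ∀ (μ' : Fin (m + 1) → ℕ) (U' B' : MvPowerSeries (Fin (m + 1)) k), constantCoeff U' ≠ 0 → (∃ l, Odd (μ' l)) →
      ∑ l, μ' l < ∑ l, μ l →
      CobordantGame.Won k (m + 1 + 1) (X (Fin.last (m + 1)) ^ 2 +
        (rename (Fin.succAboveEmb (Fin.last (m + 1))) ((∏ l, X l ^ μ' l) * U') +
          rename (Fin.succAboveEmb (Fin.last (m + 1))) ((∏ l, X l ^ ((μ' l + 1) / 2)) * B') * X (Fin.last (m + 1))))) :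
    CobordantGame.Won k (m + 1 + 1) (X (Fin.last (m + 1)) ^ 2 +
      (rename (Fin.succAboveEmb (Fin.last (m + 1))) ((∏ l, X l ^ μ l) * U) +
        rename (Fin.succAboveEmb (Fin.last (m + 1))) ((∏ l, X l ^ ((μ l + 1) / 2)) * Bc) * X (Fin.last (m + 1)))) := by
  classical
  rw [prod_X_pow_ceil_eq_of_le_one μ hμ]
  set w : Fin (m + 1) → ℕ := fun l => if l = a ∨ l = b then 1 else 0 with hw
  have hwa : w a = 1 := by rw [hw]; dsimp only; rw [if_pos (Or.inl rfl)]
  have hwb : w b = 1 := by rw [hw]; dsimp only; rw [if_pos (Or.inr rfl)]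
  have hwe : w e = 0 := by rw [hw]; dsimp only; rw [if_neg (not_or.mpr ⟨hea, heb⟩)]
  have hwle : ∀ l, w l ≤ 1 := fun l => by rw [hw]; dsimp only; split_ifs <;> omega
  have hwpos : ∀ l, w l ≠ 0 → l = a ∨ l = b := fun l hl => by
    by_contra h
    rw [hw] at hl
    exact hl (if_neg h)
  have hdeg : ∑ l, w l * μ l = 2 := by rw [hw, sum_indicator_pair_mul hab, ha, hb]
  rw [MonicDoublePointLift.monic_two_eq_sum]
  refine won_monic_of_linearBlowup p hp k (m + 1) 2 two_pos w
    (fun l hl hdvd => hp.one_lt.ne' (Nat.dvd_one.mp (by rwa [le_antisymm (hwle l) hl] at hdvd)))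
    (![(∏ l, X l ^ μ l) * U, (∏ l, X l ^ μ l) * Bc]) ?_ ?_
  · -- permissibility: both coefficients carry the factor `x_e'` after the chart
    intro c hc j
    have hfe : constantCoeff (∏ l, (C (c l) + X l.succ) ^ μ l : MvPowerSeries (Fin (m + 1 + 1)) k) = 0 := by
      rw [map_prod]
      refine Finset.prod_eq_zero (Finset.mem_univ e) ?_
      rw [map_pow, map_add, constantCoeff_C, constantCoeff_X, add_zero, hc e hwe, he, pow_one]
    fin_cases j
    · refine ⟨(∏ l, (C (c l) + X l.succ) ^ μ l) * subst (CobordantChart.chart w c) U, ?_, ?_⟩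
      · simp only [Fin.zero_eta, Matrix.cons_val_zero, Nat.sub_zero]
        rw [subst_chart_prod_X_pow_mul w c hc, hdeg]
      · rw [map_mul, hfe, zero_mul]
    · refine ⟨X 0 * ((∏ l, (C (c l) + X l.succ) ^ μ l) * subst (CobordantChart.chart w c) Bc), ?_, ?_⟩
      · simp only [Fin.mk_one, Matrix.cons_val_one, Matrix.cons_val_zero]
        rw [subst_chart_prod_X_pow_mul w c hc, hdeg]
        ring
      · rw [map_mul, constantCoeff_X, zero_mul]
  · -- the slice at a live slot `i₀ ∈ {a, b}`
    intro c hc i₀ hci₀ B hB hS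
    have hch := CobordantChart.hasSubst_chart w c hc
    have hX0 : (X 0 : MvPowerSeries (Fin (m + 1 + 1)) k) ≠ 0 := FormalCoordChange.X_ne_zero' 0
    have hB0 : B 0 = (∏ l, (C (c l) + X l.succ) ^ μ l) * subst (CobordantChart.chart w c) U := by
      have h := hB 0
      simp only [Matrix.cons_val_zero, Fin.val_zero, Nat.sub_zero] at h
      rw [subst_chart_prod_X_pow_mul w c hc, hdeg] at h
      exact (mul_left_cancel₀ (pow_ne_zero 2 hX0) h).symm
    have hB1 : B 1 = X 0 * ((∏ l, (C (c l) + X l.succ) ^ μ l) * subst (CobordantChart.chart w c) Bc) := by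
      have h := hB 1
      simp only [Matrix.cons_val_one, Matrix.cons_val_zero, Fin.val_one] at h
      rw [subst_chart_prod_X_pow_mul w c hc, hdeg, show ((X 0 : MvPowerSeries (Fin (m + 1 + 1)) k) ^ 2) = X 0 ^ (2 - 1) * X 0 by ring,
        mul_assoc] at h
      exact (mul_left_cancel₀ (pow_ne_zero _ hX0) h).symm
    have hi₀ : i₀ = a ∨ i₀ = b := hwpos i₀ (fun h => hci₀ (hc i₀ h))
    have hei₀ : e ≠ i₀ := by rintro rfl; rcases hi₀ with h | h; exact hea h; exact heb h
    -- the slice of `B 0`, `B 1`: `x^{μ''} · V` resp. `s · x^{μ''} · V'` up to the slot cycle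
    set μ'' : Fin (m + 1) → ℕ := fun l => if l = i₀ then 0 else if c l = 0 then μ l else 0 with hμ''
    set V : Fin (m + 1) → MvPowerSeries (Fin (m + 1)) k := fun l => if μ l = 0 then 1 else
      if l = i₀ then C (c l) else if c l = 0 then 1 else C (c l) + X (Fin.cycleRange i₀ l) with hV
    have hfactor : ∀ l, (C (c l) + if l = i₀ then (0 : MvPowerSeries (Fin (m + 1)) k) else X (Fin.predAbove i₀ l.succ)) ^ μ l =
        X (Fin.cycleRange i₀ l) ^ μ'' l * V l := by
      intro l
      rw [hμ'', hV]
      dsimp only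
      rcases Nat.le_one_iff_eq_zero_or_eq_one.mp (hμ l) with h0 | h1
      · rw [h0, pow_zero, if_pos rfl]
        have : (if l = i₀ then 0 else if c l = 0 then 0 else 0) = 0 := by split_ifs <;> rfl
        rw [this, pow_zero, one_mul]
      · rw [h1, pow_one, if_neg one_ne_zero]
        by_cases hl : l = i₀
        · rw [if_pos hl, if_pos hl, if_pos hl, add_zero, pow_zero, one_mul]
        · rw [if_neg hl, if_neg hl, if_neg hl, predAbove_succ_eq_cycleRange i₀ l hl]
          by_cases hcl : c l = 0
          · rw [if_pos hcl, if_pos hcl, hcl, map_zero, zero_add, pow_one, mul_one]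
          · rw [if_neg hcl, if_neg hcl, pow_zero, one_mul]
    have hV0 : ∀ l, constantCoeff (V l) ≠ 0 := by
      intro l
      rw [hV]
      dsimp only
      split_ifs with h1 h2 h3
      · rw [map_one]; exact one_ne_zero
      · rw [constantCoeff_C, h2]; exact hci₀
      · rw [map_one]; exact one_ne_zero
      · rw [map_add, constantCoeff_C, constantCoeff_X, add_zero]; exact h3
    have hμ''le : ∀ l, μ'' l ≤ 1 := fun l => by
      rw [hμ'']; dsimp only; have := hμ l; split_ifs <;> omega
    set W : MvPowerSeries (Fin (m + 1)) k := (∏ l, V l) * TupleGame.slice i₀ (subst (CobordantChart.chart w c) U) with hW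
    set W₁ : MvPowerSeries (Fin (m + 1)) k := X 0 * ((∏ l, V l) * TupleGame.slice i₀ (subst (CobordantChart.chart w c) Bc)) with hW₁
    have hW0 : constantCoeff W ≠ 0 := by
      rw [hW, map_mul, map_prod, WildTerminal.constantCoeff_slice, constantCoeff_subst_chart w c hc]
      exact mul_ne_zero (Finset.prod_ne_zero_iff.mpr fun l _ => hV0 l) hU
    have hprod : (∏ l, (C (c l) + if l = i₀ then (0 : MvPowerSeries (Fin (m + 1)) k) else X (Fin.predAbove i₀ l.succ)) ^ μ l) =
        (∏ l, X l ^ μ'' ((Fin.cycleRange i₀).symm l)) * ∏ l, V l := by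
      rw [Finset.prod_congr rfl fun l _ => hfactor l, Finset.prod_mul_distrib,
        ← Equiv.prod_comp (Fin.cycleRange i₀) (fun l => (X l : MvPowerSeries (Fin (m + 1)) k) ^ μ'' ((Fin.cycleRange i₀).symm l))]
      simp only [Equiv.symm_apply_apply]
    have hslice₀ : TupleGame.slice i₀ (B 0) = (∏ l, X l ^ μ'' ((Fin.cycleRange i₀).symm l)) * W := by
      rw [hB0, slice_prod_linFactors_mul, hprod, hW]
      ring
    have hslice₁ : TupleGame.slice i₀ (B 1) = (∏ l, X l ^ ((μ'' ((Fin.cycleRange i₀).symm l) + 1) / 2)) * W₁ := by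
      rw [prod_X_pow_ceil_eq_of_le_one _ (fun l => hμ''le _), hB1, ← pow_one (X 0 : MvPowerSeries (Fin (m + 1 + 1)) k),
        MultiplicityLift.slice_X_zero_pow_mul, slice_prod_linFactors_mul, hprod, hW₁, pow_one]
      ring
    have hform : X (Fin.last (m + 1)) ^ 2 + ∑ j : Fin 2, rename (Fin.succAboveEmb (Fin.last (m + 1)))
        (TupleGame.slice i₀ (B j)) * X (Fin.last (m + 1)) ^ (j : ℕ) =
        X (Fin.last (m + 1)) ^ 2 + (rename (Fin.succAboveEmb (Fin.last (m + 1))) ((∏ l, X l ^ μ'' ((Fin.cycleRange i₀).symm l)) * W) +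
          rename (Fin.succAboveEmb (Fin.last (m + 1)))
            ((∏ l, X l ^ ((μ'' ((Fin.cycleRange i₀).symm l) + 1) / 2)) * W₁) * X (Fin.last (m + 1))) := by
      rw [MonicDoublePointLift.sum_two_eq_monic, hslice₀, hslice₁]
    rw [hform]
    refine IH (fun l => μ'' ((Fin.cycleRange i₀).symm l)) W W₁ hW0 ⟨Fin.cycleRange i₀ e, ?_⟩ ?_
    · rw [Equiv.symm_apply_apply, hμ'']
      dsimp only
      rw [if_neg hei₀, if_pos (hc e hwe), he]
      exact odd_one
    · rw [Equiv.sum_comp (Fin.cycleRange i₀).symm (fun l => μ'' l)]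
      have hμi₀ : μ i₀ = 1 := by rcases hi₀ with rfl | rfl; exact ha; exact hb
      refine Finset.sum_lt_sum (fun l _ => ?_) ⟨i₀, Finset.mem_univ _, ?_⟩
      · rw [hμ'']; dsimp only; split_ifs <;> omega
      · rw [hμ'']; dsimp only; rw [if_pos rfl, hμi₀]; exact one_pos

/-! ### Exponent bookkeeping -/

/-- Splitting off `x_i` from `x^{⌈μ/2⌉}`: `⌈μ/2⌉ = e_i + ⌈(μ - 2e_i)/2⌉` (`μ_i ≥ 2`). -/
theorem prod_X_pow_ceil_eq_X_mul (μ : Fin (m + 1) → ℕ) (i : Fin (m + 1)) (hi : 2 ≤ μ i) :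
    (∏ l, (X l : MvPowerSeries (Fin (m + 1)) k) ^ ((μ l + 1) / 2)) =
      X i * ∏ l, (X l : MvPowerSeries (Fin (m + 1)) k) ^ ((Function.update μ i (μ i - 2) l + 1) / 2) := by
  rw [prod_X_pow_eq_mul_prod_update (fun l => (μ l + 1) / 2) i 1 (by omega), pow_one]
  congr 2
  funext l
  congr 1
  by_cases hl : l = i
  · subst hl
    simp only [Function.update_self]
    omega
  · rw [Function.update_of_ne hl, Function.update_of_ne hl]

/-- Splitting off `x_i²` from `x^{2ν}`: `x^{2ν} = x_i² · x^{2(ν - e_i)}` (`ν_i ≥ 1`). -/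
theorem prod_X_pow_two_mul_eq_X_sq_mul (ν : Fin (m + 1) → ℕ) (i : Fin (m + 1)) (hi : 1 ≤ ν i) :
    (∏ l, (X l : MvPowerSeries (Fin (m + 1)) k) ^ (2 * ν l)) =
      X i ^ 2 * ∏ l, (X l : MvPowerSeries (Fin (m + 1)) k) ^ (2 * Function.update ν i (ν i - 1) l) := by
  rw [prod_X_pow_eq_mul_prod_update (fun l => 2 * ν l) i 2 (by omega)]
  congr 2
  funext l
  congr 1
  by_cases hl : l = i
  · subst hl
    simp only [Function.update_self]
    omega
  · rw [Function.update_of_ne hl, Function.update_of_ne hl]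

/-! ### (M2) two smooth sheets -/

/-- (M2), induction on `Σ ν ≤ n` (characteristic `2`). -/
theorem sepSheetsDoublePointWon_aux (k : Type) [Field k] [CharP k 2] {m : ℕ} :
    ∀ (n : ℕ) (ν : Fin (m + 1) → ℕ) (V W : MvPowerSeries (Fin (m + 1)) k), ∑ l, ν l ≤ n → constantCoeff V ≠ 0 →
      CobordantGame.Won k (m + 1 + 1) (X (Fin.last (m + 1)) ^ 2 +
        (rename (Fin.succAboveEmb (Fin.last (m + 1))) ((∏ l, X l ^ (2 * ν l)) * W) +
          rename (Fin.succAboveEmb (Fin.last (m + 1))) ((∏ l, X l ^ ν l) * V) * X (Fin.last (m + 1)))) := by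
  classical
  -- `ν = 0`: the `y`-linear term `V(0)`
  have hbase : ∀ (ν : Fin (m + 1) → ℕ) (V W : MvPowerSeries (Fin (m + 1)) k), (∀ l, ν l = 0) → constantCoeff V ≠ 0 →
      CobordantGame.Won k (m + 1 + 1) (X (Fin.last (m + 1)) ^ 2 +
        (rename (Fin.succAboveEmb (Fin.last (m + 1))) ((∏ l, X l ^ (2 * ν l)) * W) +
          rename (Fin.succAboveEmb (Fin.last (m + 1))) ((∏ l, X l ^ ν l) * V) * X (Fin.last (m + 1)))) := by
    intro ν V W hν hV
    refine (wonBy_zero_of_not_isSingular (Nat.succ_pos _) (not_isSingular_dp1_of_constantCoeff_ne_zero ?_)).won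
    rw [Finset.prod_eq_one (fun j _ => by rw [hν j, pow_zero]), one_mul]
    exact hV
  intro n
  induction n with
  | zero =>
    intro ν V W hsum hV
    exact hbase ν V W (fun l => by
      have := Finset.single_le_sum (fun l _ => Nat.zero_le (ν l)) (Finset.mem_univ l); omega) hV
  | succ n IH =>
    intro ν V W hsum hV
    by_cases h1 : ∃ i, 1 ≤ ν i
    · obtain ⟨i, hi⟩ := h1
      by_cases hbot : ν i = 1 ∧ ∀ l, l ≠ i → ν l = 0
      · -- `ν = e_i`: the two-sheets bottom
        have hprod₁ : (∏ l, (X l : MvPowerSeries (Fin (m + 1)) k) ^ ν l) = X i :=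
          prod_X_pow_eq_X_of_single ν i hbot.1 hbot.2
        have hprod₂ : (∏ l, (X l : MvPowerSeries (Fin (m + 1)) k) ^ (2 * ν l)) = X i ^ 2 := by
          rw [Finset.prod_eq_single i (fun l _ hl => by rw [hbot.2 l hl, mul_zero, pow_zero]) (fun h => absurd (Finset.mem_univ i) h),
            hbot.1, mul_one]
        rw [hprod₁, hprod₂]
        exact won_dp1_X_sq_mul k i hV W
      · -- a curve step at `i`
        set ν' : Fin (m + 1) → ℕ := Function.update ν i (ν i - 1) with hν'
        have hsumν : ∑ l, ν' l + 1 = ∑ l, ν l := sum_update_sub_add ν i 1 hi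
        have hν'pos : ∃ l, 0 < ν' l := by
          by_cases h2 : 2 ≤ ν i
          · exact ⟨i, by rw [hν', Function.update_self]; omega⟩
          · have h1 : ν i = 1 := by omega
            obtain ⟨l, hl⟩ : ∃ l, l ≠ i ∧ ν l ≠ 0 := by
              by_contra h
              push Not at h
              exact hbot ⟨h1, h⟩
            exact ⟨l, by rw [hν', Function.update_of_ne hl.1]; exact Nat.pos_of_ne_zero hl.2⟩
        obtain ⟨l₁, hl₁⟩ := hν'pos
        have hl₁' : 0 < 2 * ν' l₁ := by omega
        refine won_dp1_of_curveStep 2 Nat.prime_two k i _ ((∏ l, X l ^ (2 * ν' l)) * W) _ ((∏ l, X l ^ ν' l) * V)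
          (by rw [← mul_assoc, ← prod_X_pow_two_mul_eq_X_sq_mul ν i hi])
          (by rw [← mul_assoc, ← pow_one (X i : MvPowerSeries (Fin (m + 1)) k), ← prod_X_pow_eq_mul_prod_update ν i 1 hi])
          (by rw [map_mul, constantCoeff_prod_X_pow_eq_zero (fun l => 2 * ν' l) hl₁', zero_mul])
          (by rw [map_mul, constantCoeff_prod_X_pow_eq_zero ν' hl₁, zero_mul]) ?_
        intro c hc hS
        have hform₀ : C (c ^ 2) * subst (fun l : Fin (m + 1) => if l = i then C c * X 0
            else (X (Fin.predAbove i l.succ) : MvPowerSeries (Fin (m + 1)) k)) ((∏ l, X l ^ (2 * ν' l)) * W) =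
            (∏ l, X l ^ (2 * ν' ((Fin.cycleRange i).symm l))) * (C (c ^ 2) * (C (c ^ (2 * ν' i)) *
              subst (fun l : Fin (m + 1) => if l = i then C c * X 0
                else (X (Fin.predAbove i l.succ) : MvPowerSeries (Fin (m + 1)) k)) W)) := by
          rw [subst_rho_prod_X_pow_mul]; ring
        have hform₁ : C c * subst (fun l : Fin (m + 1) => if l = i then C c * X 0
            else (X (Fin.predAbove i l.succ) : MvPowerSeries (Fin (m + 1)) k)) ((∏ l, X l ^ ν' l) * V) =
            (∏ l, X l ^ ν' ((Fin.cycleRange i).symm l)) * (C c * (C (c ^ ν' i) *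
              subst (fun l : Fin (m + 1) => if l = i then C c * X 0
                else (X (Fin.predAbove i l.succ) : MvPowerSeries (Fin (m + 1)) k)) V)) := by
          rw [subst_rho_prod_X_pow_mul]; ring
        rw [hform₀, hform₁] at hS ⊢
        refine IH (fun l => ν' ((Fin.cycleRange i).symm l)) _ _ ?_ ?_
        · rw [Equiv.sum_comp (Fin.cycleRange i).symm (fun l => ν' l)]
          omega
        · rw [map_mul, map_mul, constantCoeff_C, constantCoeff_C, constantCoeff_subst_rho]
          exact mul_ne_zero hc (mul_ne_zero (pow_ne_zero _ hc) hV)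
    · push Not at h1
      exact hbase ν V W (fun l => Nat.lt_one_iff.mp (h1 l)) hV

/-- **(M2) TWO SMOOTH SHEETS** `y² + x^ν V · y + x^{2ν} · W` (`V(0) ≠ 0`, `W` arbitrary) IS WON — characteristic `2`, every field,
every dimension, no hypothesis on other germs. -/
theorem sepSheetsDoublePointWon (k : Type) [Field k] [CharP k 2] {m : ℕ} (ν : Fin (m + 1) → ℕ)
    (V W : MvPowerSeries (Fin (m + 1)) k) (hV : constantCoeff V ≠ 0) :
    CobordantGame.Won k (m + 1 + 1) (X (Fin.last (m + 1)) ^ 2 +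
      (rename (Fin.succAboveEmb (Fin.last (m + 1))) ((∏ l, X l ^ (2 * ν l)) * W) +
        rename (Fin.succAboveEmb (Fin.last (m + 1))) ((∏ l, X l ^ ν l) * V) * X (Fin.last (m + 1)))) :=
  sepSheetsDoublePointWon_aux k _ ν V W le_rfl hV

end SepTerminalDoublePointDim

end Summit.ResolutionOfSingularities.ResolutionOfSingularities.Theorems
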